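import Summits.HodgeConjecture.HodgeConjecture.Theorems.GenericDivisibilityHodgeClassesGenericallyDivisibleDischarged
import Summits.HodgeConjecture.HodgeConjecture.Theorems.LinearSystemTorelliTranscendentalOrSupportedStubOfMiddleOfHodgeEffective
import Literature.AlgebraicGeometry.HodgeTheory.RationalLatticeIntegral
import Literature.AlgebraicGeometry.HodgeTheory.IntegralClassesCountable
import Literature.AlgebraicGeometry.HodgeTheory.HodgeFiltration
import HarnessLib
import Summits.HodgeConjecture.HodgeConjecture.Theorems.LimitExtensionHodgeFourfoldsBinders

/-!
# Route GenericDivisibility — the Hodge-restricted bound `C2_Hdg` suffices, and the route is then an exact reformulation of the Hodge conjecture modulo `TorsionDiesGenerically`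

Route-level record (prover seat 0, session 9; supports the cruxes stmt-HodgeConjecture-18466 `C1 =
HodgeClassesGenericallyDivisible` and stmt-HodgeConjecture-18467 `C2 = GenericDivisibilityBounded`).

The route's deciding theorem `GenericDivisibility.closes` consumes the two cruxes ONLY through the
seam `MiddleConiveauOne` (stmt-HodgeConjecture-18468), and that seam applies C2 only to integral
lifts `z` of rational classes of Hodge type `(p, p)` — i.e. to HODGE classes.  Hence the
Hodge-restricted form of C2,

  `C2_Hdg`: for `p ≥ 1`, `X` smooth projective of dimension `2p`, and an INTEGRAL class `z` whose
  complexification is of Hodge type `(p, p)`: if `z` is divisible by every `m ≥ 1` on the complex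
  points of some non-empty Zariski open (depending on `m`), then `z ⊗ ℂ ∈ N¹ H²ᵖ(X(ℂ); ℂ)`,

spelled inline below (no new definition), already closes the route:

* `genericDivisibility_middleConiveauOne_of_hodgeBounded` : C1 → C2_Hdg → (every rational middle
  `(p, p)` class has coniveau `≥ 1`) — the seam, verbatim proof of item 18468 with C2_Hdg;
* `genericDivisibility_hodgeConjecture_of_hodgeBounded` : C1 → C2_Hdg → HodgeConjecture — via the
  tree's theorem `hodgeConjecture_of_middleDivisorSupport` (Thomas 2005: middle divisor support is
  the whole Hodge conjecture; strong induction on the dimension, all inputs proved in the tree);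
* `genericDivisibilityBounded_imp_hodgeBounded` : C2 → C2_Hdg (the filed crux is the stronger one).

Conversely, and this is the point of the record, C2_Hdg — unlike the Hodge-free C2 as filed — is
IMPLIED by the Hodge conjecture, unconditionally and pointwise in `X`
(`genericDivisibility_hodgeBounded_at_of_hodgeConjectureFor`: an integral `(p, p)` class is a
rational Hodge class, algebraic by HC, and `algebraicClasses X p = Nᵖ ⊆ N¹` for `p ≥ 1`; the
divisibility hypothesis is not even used), while C1 is implied by HC granted the route's support
item `TorsionDiesGenerically` (stmt-HodgeConjecture-18850 = Colliot-Thélène–Voisin 2012 Thm. 3.1, a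
published theorem; `hodgeClassesGenericallyDivisible_of_torsionDiesGenerically_of_hodgeConjecture`,
landed with the Dimca finiteness discharged).  Therefore

* `genericDivisibility_hodgeConjecture_iff_of_torsionDiesGenerically` :
  `TorsionDiesGenerically → (HodgeConjecture ↔ C1 ∧ C2_Hdg)`.

So, modulo one printed theorem, the pair (C1, C2_Hdg) is an EXACT reformulation of the Hodge
conjecture, whereas the Hodge-free C2 as filed is not known to follow from HC: a counterexample to
C2 by a NON-Hodge phantom (a generically infinitely divisible integral class outside `N¹ ⊗ ℚ` with
no `(p, p)` constraint — a generalised-Hodge-type statement, cf. the crux lead's HEART-c2 §E–F for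
stmt-18467) would kill the filed crux without touching the route's actual logical need.  Planner
note (D-0014): restating C2 as C2_Hdg costs the route nothing (`closes` goes through verbatim, first
theorem below) and removes that attack surface.

No definitions, no sorry; the only named-fact hypothesis is the route's own support item
`TorsionDiesGenerically`, and only in the last theorem.
-/

-- `Summit.HodgeConjecture.HodgeConjecture.Theorems` is the mandated namespace (single-problem
-- summit: Problem = Summit), which `linter.dupNamespace` flags on every declaration; the lakefile
-- turns the linter off tree-wide (weak option), restated here so stand-alone elaboration is
-- warning-free too.
set_option linter.dupNamespace false

noncomputable section

namespace Summit.HodgeConjecture.HodgeConjecture.Theorems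

open Literature.AlgebraicGeometry.Motives Literature.AlgebraicGeometry.HodgeTheory
  Literature.AlgebraicTopology.SingularHomology
open Summit.HodgeConjecture.HodgeConjecture.Theses.GenericDivisibility

/-- **The seam with the Hodge-restricted bound**: C1 (`HodgeClassesGenericallyDivisible`) and
`C2_Hdg` (C2 = `GenericDivisibilityBounded` restricted to integral classes whose complexification
is of type `(p, p)`, spelled inline) imply that every rational middle-degree class of Hodge type
`(p, p)` on a smooth projective complex `2p`-fold (`p ≥ 1`) has coniveau `≥ 1`.  Verbatim the proof
of item stmt-HodgeConjecture-18468: an integral multiple `N • c = z ⊗ ℂ` (`N ≥ 1`, Voisin I §7.1.1 /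
Hatcher Thm. 3.2), which is still of type `(p, p)`; C1 then C2_Hdg on `z`; divide by `N` in the
`ℂ`-submodule `N¹`.  [cite: VoisinHodgeI2002, §7.1.1] [cite: HatcherAT2002, §3.1 Thm. 3.2] -/
theorem genericDivisibility_middleConiveauOne_of_hodgeBounded
    (h1 : HodgeClassesGenericallyDivisible)
    (h2 : ∀ ⦃p : ℕ⦄ ⦃X : SchemeOver ℂ⦄, 1 ≤ p → IsSmoothProjective (2 * p) X →
      ∀ z : singularCohomology ℤ ℤ (ComplexPoints X) (2 * p),
        IsOfHodgeType (2 * p) X (2 * p) p p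
          (singularCohomology.ringChange (Int.castRingHom ℂ) (ComplexPoints X) (2 * p) z) →
        (∀ m : ℕ, 1 ≤ m → ∃ Z : Set X.left, IsClosed Z ∧ Z ≠ Set.univ ∧
          ∃ y : singularCohomology ℤ ℤ (complexPointsCompl X Z) (2 * p),
            m • y = singularCohomology.map ℤ ℤ
              (⟨Subtype.val, continuous_subtype_val⟩ : C(complexPointsCompl X Z, ComplexPoints X))
              (2 * p) z) →
        singularCohomology.ringChange (Int.castRingHom ℂ) (ComplexPoints X) (2 * p) z ∈
          supportedClasses X (2 * p) 1) :
    ∀ ⦃p : ℕ⦄ ⦃X : SchemeOver ℂ⦄, 1 ≤ p → IsSmoothProjective (2 * p) X →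
      ∀ c : complexBetti X (2 * p), IsRationalClass c → IsOfHodgeType (2 * p) X (2 * p) p p c →
        c ∈ supportedClasses X (2 * p) 1 := by
  intro p X hp hX c hc hpp
  -- an integral multiple `N • c`, `N ≥ 1`, lifted to an integral class `z`
  obtain ⟨N, hN, hNc⟩ := hc.exists_nsmul_isIntegralClass hX
  obtain ⟨z, hz⟩ := (isIntegralClass_iff_mem_range_ringChange _).1 hNc
  -- `z ⊗ ℂ = N • c` is of Hodge type `(p, p)`
  have hzpp : IsOfHodgeType (2 * p) X (2 * p) p p
      (singularCohomology.ringChange (Int.castRingHom ℂ) (ComplexPoints X) (2 * p) z) := by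
    rw [hz]
    obtain ⟨A, hA⟩ := hpp
    exact ⟨A, by rw [map_smul]; exact Submodule.smul_mem _ _ hA⟩
  -- C1: `z` is divisible by every `m ≥ 1` on non-empty Zariski opens; C2_Hdg: `z ⊗ ℂ ∈ N¹`
  have hmem : singularCohomology.ringChange (Int.castRingHom ℂ) (ComplexPoints X) (2 * p) z ∈
      supportedClasses X (2 * p) 1 :=
    h2 hp hX z hzpp (h1 hp hX z hzpp)
  rw [hz] at hmem
  -- divide by `N` in the `ℂ`-submodule `N¹`
  have hN' : (N : ℂ) ≠ 0 := Nat.cast_ne_zero.2 hN.ne'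
  have hc' : (N : ℂ)⁻¹ • ((N : ℂ) • c) ∈ supportedClasses X (2 * p) 1 :=
    Submodule.smul_mem _ _ hmem
  rwa [smul_smul, inv_mul_cancel₀ hN', one_smul] at hc'

/-- **C1 ∧ C2_Hdg ⟹ the Hodge conjecture**: the seam above lands in "middle divisor support"
(every rational middle `(p, p)` class on a smooth projective `2p`-fold, `p ≥ 1`, has coniveau
`≥ 1`), which is the whole Hodge conjecture by the tree's theorem
`hodgeConjecture_of_middleDivisorSupport` (Thomas 2005 Thm. 1 / Prop. 2: strong induction on the
dimension — Hodge models, Lefschetz pencils below the middle, hard Lefschetz above it, divisor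
induction in the middle; all inputs proved in the tree).  So the route's deciding theorem needs C2
only in its Hodge-restricted form. [cite: Thomas2005Nodes, Thm. 1 and §2 Prop. 2]
[cite: DecataldoMigliorini2009, §4 Prop. 4.5] -/
theorem genericDivisibility_hodgeConjecture_of_hodgeBounded
    (h1 : HodgeClassesGenericallyDivisible)
    (h2 : ∀ ⦃p : ℕ⦄ ⦃X : SchemeOver ℂ⦄, 1 ≤ p → IsSmoothProjective (2 * p) X →
      ∀ z : singularCohomology ℤ ℤ (ComplexPoints X) (2 * p),
        IsOfHodgeType (2 * p) X (2 * p) p p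
          (singularCohomology.ringChange (Int.castRingHom ℂ) (ComplexPoints X) (2 * p) z) →
        (∀ m : ℕ, 1 ≤ m → ∃ Z : Set X.left, IsClosed Z ∧ Z ≠ Set.univ ∧
          ∃ y : singularCohomology ℤ ℤ (complexPointsCompl X Z) (2 * p),
            m • y = singularCohomology.map ℤ ℤ
              (⟨Subtype.val, continuous_subtype_val⟩ : C(complexPointsCompl X Z, ComplexPoints X))
              (2 * p) z) →
        singularCohomology.ringChange (Int.castRingHom ℂ) (ComplexPoints X) (2 * p) z ∈
          supportedClasses X (2 * p) 1) :
    _root_.HodgeConjecture :=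
  hodgeConjecture_of_middleDivisorSupport (genericDivisibility_middleConiveauOne_of_hodgeBounded h1 h2)

/-- **The filed crux C2 implies its Hodge-restricted form C2_Hdg** (drop the Hodge-type
hypothesis): the crux `GenericDivisibilityBounded` as filed is the STRONGER, Hodge-free statement.
[cite: ColliotTheleneVoisin2012, §3 Thm. 3.1] -/
theorem genericDivisibilityBounded_imp_hodgeBounded (h2 : GenericDivisibilityBounded) :
    ∀ ⦃p : ℕ⦄ ⦃X : SchemeOver ℂ⦄, 1 ≤ p → IsSmoothProjective (2 * p) X →
      ∀ z : singularCohomology ℤ ℤ (ComplexPoints X) (2 * p),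
        IsOfHodgeType (2 * p) X (2 * p) p p
          (singularCohomology.ringChange (Int.castRingHom ℂ) (ComplexPoints X) (2 * p) z) →
        (∀ m : ℕ, 1 ≤ m → ∃ Z : Set X.left, IsClosed Z ∧ Z ≠ Set.univ ∧
          ∃ y : singularCohomology ℤ ℤ (complexPointsCompl X Z) (2 * p),
            m • y = singularCohomology.map ℤ ℤ
              (⟨Subtype.val, continuous_subtype_val⟩ : C(complexPointsCompl X Z, ComplexPoints X))
              (2 * p) z) →
        singularCohomology.ringChange (Int.castRingHom ℂ) (ComplexPoints X) (2 * p) z ∈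
          supportedClasses X (2 * p) 1 :=
  fun _ _ hp hX z _ hdiv ↦ h2 hp hX z hdiv

/-- **HC at `X` ⟹ C2_Hdg at `X`, unconditionally** (pointwise in the variety; no
`TorsionDiesGenerically`, and the divisibility hypothesis is not used): an integral class `z`
whose complexification is of type `(p, p)` gives a RATIONAL Hodge class `z ⊗ ℂ`
(`IsIntegralClass.isRationalClass`), algebraic by `HodgeConjectureFor (2 * p) X`, and
`algebraicClasses X p = Nᵖ H²ᵖ ⊆ N¹ H²ᵖ` for `p ≥ 1` (`supportedClasses_mono`).  This is the
direction that FAILS to be available for the Hodge-free C2 as filed.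
[cite: GrothendieckTopology1969, §1] [cite: VoisinHodgeI2002, §11.3] -/
theorem genericDivisibility_hodgeBounded_at_of_hodgeConjectureFor {p : ℕ} {X : SchemeOver ℂ}
    (hp : 1 ≤ p) (hHC : HodgeConjectureFor (2 * p) X)
    (z : singularCohomology ℤ ℤ (ComplexPoints X) (2 * p))
    (hz : IsOfHodgeType (2 * p) X (2 * p) p p
      (singularCohomology.ringChange (Int.castRingHom ℂ) (ComplexPoints X) (2 * p) z)) :
    singularCohomology.ringChange (Int.castRingHom ℂ) (ComplexPoints X) (2 * p) z ∈
      supportedClasses X (2 * p) 1 := by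
  have hint : IsIntegralClass
      (singularCohomology.ringChange (Int.castRingHom ℂ) (ComplexPoints X) (2 * p) z) :=
    (isIntegralClass_iff_mem_range_ringChange _).2 ⟨z, rfl⟩
  exact supportedClasses_mono X (2 * p) hp (hHC.2 p _ hint.isRationalClass hz)

/-- **HC ⟹ C2_Hdg** (global form of the previous theorem). [cite: VoisinHodgeI2002, §11.3] -/
theorem genericDivisibility_hodgeBounded_of_hodgeConjecture (hHC : _root_.HodgeConjecture) :
    ∀ ⦃p : ℕ⦄ ⦃X : SchemeOver ℂ⦄, 1 ≤ p → IsSmoothProjective (2 * p) X →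
      ∀ z : singularCohomology ℤ ℤ (ComplexPoints X) (2 * p),
        IsOfHodgeType (2 * p) X (2 * p) p p
          (singularCohomology.ringChange (Int.castRingHom ℂ) (ComplexPoints X) (2 * p) z) →
        (∀ m : ℕ, 1 ≤ m → ∃ Z : Set X.left, IsClosed Z ∧ Z ≠ Set.univ ∧
          ∃ y : singularCohomology ℤ ℤ (complexPointsCompl X Z) (2 * p),
            m • y = singularCohomology.map ℤ ℤ
              (⟨Subtype.val, continuous_subtype_val⟩ : C(complexPointsCompl X Z, ComplexPoints X))
              (2 * p) z) →
        singularCohomology.ringChange (Int.castRingHom ℂ) (ComplexPoints X) (2 * p) z ∈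
          supportedClasses X (2 * p) 1 :=
  fun _ _ hp hX z hz _ ↦ genericDivisibility_hodgeBounded_at_of_hodgeConjectureFor hp (hHC hX) z hz

/-- **Modulo `TorsionDiesGenerically`, the route is an exact reformulation of the Hodge
conjecture**: granted the route's support item `TorsionDiesGenerically` (stmt-HodgeConjecture-18850
= Colliot-Thélène–Voisin 2012 Thm. 3.1, the Bloch–Kato shadow "the Zariski sheaf `𝓗²ᵖ(ℤ)` is
torsion-free"), `HodgeConjecture ↔ C1 ∧ C2_Hdg`.  Forward: C1 by
`hodgeClassesGenericallyDivisible_of_torsionDiesGenerically_of_hodgeConjecture` (HC-implied record,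
Dimca finiteness discharged) and C2_Hdg by `genericDivisibility_hodgeBounded_of_hodgeConjecture`
(unconditional); backward: `genericDivisibility_hodgeConjecture_of_hodgeBounded` (unconditional).
CONDITIONAL on the named support item only through the forward implication to C1.
[cite: ColliotTheleneVoisin2012, §3 Thm. 3.1] [cite: Thomas2005Nodes, Thm. 1] -/
theorem genericDivisibility_hodgeConjecture_iff_of_torsionDiesGenerically :
    TorsionDiesGenerically → (_root_.HodgeConjecture ↔
      (HodgeClassesGenericallyDivisible ∧
        ∀ ⦃p : ℕ⦄ ⦃X : SchemeOver ℂ⦄, 1 ≤ p → IsSmoothProjective (2 * p) X →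
          ∀ z : singularCohomology ℤ ℤ (ComplexPoints X) (2 * p),
            IsOfHodgeType (2 * p) X (2 * p) p p
              (singularCohomology.ringChange (Int.castRingHom ℂ) (ComplexPoints X) (2 * p) z) →
            (∀ m : ℕ, 1 ≤ m → ∃ Z : Set X.left, IsClosed Z ∧ Z ≠ Set.univ ∧
              ∃ y : singularCohomology ℤ ℤ (complexPointsCompl X Z) (2 * p),
                m • y = singularCohomology.map ℤ ℤ
                  (⟨Subtype.val, continuous_subtype_val⟩ :
                    C(complexPointsCompl X Z, ComplexPoints X)) (2 * p) z) →
            singularCohomology.ringChange (Int.castRingHom ℂ) (ComplexPoints X) (2 * p) z ∈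
              supportedClasses X (2 * p) 1)) :=
  fun hT ↦
    ⟨fun hHC ↦ ⟨hodgeClassesGenericallyDivisible_of_torsionDiesGenerically_of_hodgeConjecture hT hHC,
        genericDivisibility_hodgeBounded_of_hodgeConjecture hHC⟩,
      fun h ↦ genericDivisibility_hodgeConjecture_of_hodgeBounded h.1 h.2⟩


/-! ### Pointwise packaging: for each smooth projective FOURFOLD the two cruxes at `X` are the Hodge conjecture at `X`

(Appended, session 9.)  The first open case of the route is `p = 2`.  The seam is pointwise in the
variety, and for fourfolds the tree has the unconditional converse step
`hodgeConjectureFor_four_of_supported` (divisor support of the rational `(2,2)`-classes of a smooth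
projective fourfold gives `HodgeConjectureFor 4 X`: divisor descent on the snc theorem, Lefschetz
`(1,1)` on the resolved threefolds, hard Lefschetz `(3,3)`).  Hence for every smooth projective
complex fourfold `X`, granted `TorsionDiesGenerically`, "C1 at `X`" ∧ "C2_Hdg at `X`" ⟺
`HodgeConjectureFor 4 X` — any fourfold violating either crux (in its Hodge-restricted form) is a
counterexample to the Hodge conjecture itself, and every fourfold sector where HC is a theorem of
the tree satisfies both. -/

/-- **The seam, pointwise in the variety**: for a fixed smooth projective `2p`-fold `X`,
C1 at `X` and C2_Hdg at `X` give coniveau `≥ 1` for every rational `(p, p)`-class on `X` (same proof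
as `genericDivisibility_middleConiveauOne_of_hodgeBounded`: integral multiple, C1, C2_Hdg, divide).
[cite: VoisinHodgeI2002, §7.1.1] [cite: HatcherAT2002, §3.1 Thm. 3.2] -/
theorem genericDivisibility_middleConiveauOne_at_of_hodgeBounded_at {p : ℕ} {X : SchemeOver ℂ}
    (hX : IsSmoothProjective (2 * p) X)
    (h1 : ∀ z : singularCohomology ℤ ℤ (ComplexPoints X) (2 * p),
      IsOfHodgeType (2 * p) X (2 * p) p p
        (singularCohomology.ringChange (Int.castRingHom ℂ) (ComplexPoints X) (2 * p) z) →
      ∀ m : ℕ, 1 ≤ m → ∃ Z : Set X.left, IsClosed Z ∧ Z ≠ Set.univ ∧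
        ∃ y : singularCohomology ℤ ℤ (complexPointsCompl X Z) (2 * p),
          m • y = singularCohomology.map ℤ ℤ
            (⟨Subtype.val, continuous_subtype_val⟩ : C(complexPointsCompl X Z, ComplexPoints X))
            (2 * p) z)
    (h2 : ∀ z : singularCohomology ℤ ℤ (ComplexPoints X) (2 * p),
      IsOfHodgeType (2 * p) X (2 * p) p p
        (singularCohomology.ringChange (Int.castRingHom ℂ) (ComplexPoints X) (2 * p) z) →
      (∀ m : ℕ, 1 ≤ m → ∃ Z : Set X.left, IsClosed Z ∧ Z ≠ Set.univ ∧
        ∃ y : singularCohomology ℤ ℤ (complexPointsCompl X Z) (2 * p),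
          m • y = singularCohomology.map ℤ ℤ
            (⟨Subtype.val, continuous_subtype_val⟩ : C(complexPointsCompl X Z, ComplexPoints X))
            (2 * p) z) →
      singularCohomology.ringChange (Int.castRingHom ℂ) (ComplexPoints X) (2 * p) z ∈
        supportedClasses X (2 * p) 1) :
    ∀ c : complexBetti X (2 * p), IsRationalClass c → IsOfHodgeType (2 * p) X (2 * p) p p c →
      c ∈ supportedClasses X (2 * p) 1 := by
  intro c hc hpp
  obtain ⟨N, hN, hNc⟩ := hc.exists_nsmul_isIntegralClass hX
  obtain ⟨z, hz⟩ := (isIntegralClass_iff_mem_range_ringChange _).1 hNc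
  have hzpp : IsOfHodgeType (2 * p) X (2 * p) p p
      (singularCohomology.ringChange (Int.castRingHom ℂ) (ComplexPoints X) (2 * p) z) := by
    rw [hz]
    obtain ⟨A, hA⟩ := hpp
    exact ⟨A, by rw [map_smul]; exact Submodule.smul_mem _ _ hA⟩
  have hmem : singularCohomology.ringChange (Int.castRingHom ℂ) (ComplexPoints X) (2 * p) z ∈
      supportedClasses X (2 * p) 1 :=
    h2 z hzpp (h1 z hzpp)
  rw [hz] at hmem
  have hN' : (N : ℂ) ≠ 0 := Nat.cast_ne_zero.2 hN.ne'
  have hc' : (N : ℂ)⁻¹ • ((N : ℂ) • c) ∈ supportedClasses X (2 * p) 1 :=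
    Submodule.smul_mem _ _ hmem
  rwa [smul_smul, inv_mul_cancel₀ hN', one_smul] at hc'

/-- **Fourfolds: C1 at `X` ∧ C2_Hdg at `X` ⟹ the Hodge conjecture for `X`, unconditionally.** The
pointwise seam puts every rational `(2,2)`-class of the smooth projective fourfold `X` in `N¹H⁴`,
and `hodgeConjectureFor_four_of_supported` (Thomas's divisor-support reformulation for fourfolds,
a theorem of the tree) concludes. [cite: Thomas2005Nodes, Thm. 1 and Prop. 2]
[cite: DeligneHodgeIII1974, Cor. 8.2.8] -/
theorem genericDivisibility_hodgeConjectureFor_four_of_at {X : SchemeOver ℂ}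
    (hX : IsSmoothProjective 4 X)
    (h1 : ∀ z : singularCohomology ℤ ℤ (ComplexPoints X) (2 * 2),
      IsOfHodgeType (2 * 2) X (2 * 2) 2 2
        (singularCohomology.ringChange (Int.castRingHom ℂ) (ComplexPoints X) (2 * 2) z) →
      ∀ m : ℕ, 1 ≤ m → ∃ Z : Set X.left, IsClosed Z ∧ Z ≠ Set.univ ∧
        ∃ y : singularCohomology ℤ ℤ (complexPointsCompl X Z) (2 * 2),
          m • y = singularCohomology.map ℤ ℤ
            (⟨Subtype.val, continuous_subtype_val⟩ : C(complexPointsCompl X Z, ComplexPoints X))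
            (2 * 2) z)
    (h2 : ∀ z : singularCohomology ℤ ℤ (ComplexPoints X) (2 * 2),
      IsOfHodgeType (2 * 2) X (2 * 2) 2 2
        (singularCohomology.ringChange (Int.castRingHom ℂ) (ComplexPoints X) (2 * 2) z) →
      (∀ m : ℕ, 1 ≤ m → ∃ Z : Set X.left, IsClosed Z ∧ Z ≠ Set.univ ∧
        ∃ y : singularCohomology ℤ ℤ (complexPointsCompl X Z) (2 * 2),
          m • y = singularCohomology.map ℤ ℤ
            (⟨Subtype.val, continuous_subtype_val⟩ : C(complexPointsCompl X Z, ComplexPoints X))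
            (2 * 2) z) →
      singularCohomology.ringChange (Int.castRingHom ℂ) (ComplexPoints X) (2 * 2) z ∈
        supportedClasses X (2 * 2) 1) :
    HodgeConjectureFor 4 X :=
  hodgeConjectureFor_four_of_supported hX
    (genericDivisibility_middleConiveauOne_at_of_hodgeBounded_at (p := 2) hX h1 h2)

/-- **HC at `X` ⟹ C1 at `X`, granted `TorsionDiesGenerically`** (pointwise form of the landed
record `hodgeClassesGenericallyDivisible_of_torsionDiesGenerically_of_hodgeConjecture`; Dimca's
finiteness discharged): an integral `(p, p)` class even restricts to ZERO on some non-empty Zariski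
open (`genericDivisibility_exists_restrict_eq_zero_of_hodgeConjectureFor'`), so `y = 0` divides it
by every `m`. [cite: ColliotTheleneVoisin2012, §3 Thm. 3.1] [cite: Dimca1992, Ch. 1 Cor. (6.10)] -/
theorem genericDivisibility_at_of_hodgeConjectureFor {p : ℕ} {X : SchemeOver ℂ} (hp : 1 ≤ p)
    (hX : IsSmoothProjective (2 * p) X) (hT : TorsionDiesGenerically)
    (hHC : HodgeConjectureFor (2 * p) X) :
    ∀ z : singularCohomology ℤ ℤ (ComplexPoints X) (2 * p),
      IsOfHodgeType (2 * p) X (2 * p) p p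
        (singularCohomology.ringChange (Int.castRingHom ℂ) (ComplexPoints X) (2 * p) z) →
      ∀ m : ℕ, 1 ≤ m → ∃ Z : Set X.left, IsClosed Z ∧ Z ≠ Set.univ ∧
        ∃ y : singularCohomology ℤ ℤ (complexPointsCompl X Z) (2 * p),
          m • y = singularCohomology.map ℤ ℤ
            (⟨Subtype.val, continuous_subtype_val⟩ : C(complexPointsCompl X Z, ComplexPoints X))
            (2 * p) z := by
  intro z hz m _
  obtain ⟨Z, hZ, hZu, h0⟩ :=
    genericDivisibility_exists_restrict_eq_zero_of_hodgeConjectureFor' hp hX hHC hT z hz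
  exact ⟨Z, hZ, hZu, 0, by rw [h0, smul_zero]⟩

/-- **For every smooth projective complex fourfold, the two cruxes at `X` (C2 in its Hodge-restricted
form) are EQUIVALENT to the Hodge conjecture at `X`, granted `TorsionDiesGenerically`** — the first
open case of the route, pointwise: `HodgeConjectureFor 4 X ↔ (C1 at X) ∧ (C2_Hdg at X)`.  Forward:
`genericDivisibility_at_of_hodgeConjectureFor` (uses `TorsionDiesGenerically`) and
`genericDivisibility_hodgeBounded_at_of_hodgeConjectureFor` (unconditional); backward:
`genericDivisibility_hodgeConjectureFor_four_of_at` (unconditional).  So a fourfold violating either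
crux at level `p = 2` is a counterexample to the Hodge conjecture, and both cruxes hold on every
fourfold for which `HodgeConjectureFor 4 X` is a theorem of the tree.
[cite: Thomas2005Nodes, Thm. 1] [cite: ColliotTheleneVoisin2012, §3 Thm. 3.1] -/
theorem genericDivisibility_hodgeConjectureFor_four_iff_of_torsionDiesGenerically :
    TorsionDiesGenerically → ∀ ⦃X : SchemeOver ℂ⦄, IsSmoothProjective 4 X →
      (HodgeConjectureFor 4 X ↔
        ((∀ z : singularCohomology ℤ ℤ (ComplexPoints X) (2 * 2),
            IsOfHodgeType (2 * 2) X (2 * 2) 2 2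
              (singularCohomology.ringChange (Int.castRingHom ℂ) (ComplexPoints X) (2 * 2) z) →
            ∀ m : ℕ, 1 ≤ m → ∃ Z : Set X.left, IsClosed Z ∧ Z ≠ Set.univ ∧
              ∃ y : singularCohomology ℤ ℤ (complexPointsCompl X Z) (2 * 2),
                m • y = singularCohomology.map ℤ ℤ
                  (⟨Subtype.val, continuous_subtype_val⟩ :
                    C(complexPointsCompl X Z, ComplexPoints X)) (2 * 2) z) ∧
          (∀ z : singularCohomology ℤ ℤ (ComplexPoints X) (2 * 2),
            IsOfHodgeType (2 * 2) X (2 * 2) 2 2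
              (singularCohomology.ringChange (Int.castRingHom ℂ) (ComplexPoints X) (2 * 2) z) →
            (∀ m : ℕ, 1 ≤ m → ∃ Z : Set X.left, IsClosed Z ∧ Z ≠ Set.univ ∧
              ∃ y : singularCohomology ℤ ℤ (complexPointsCompl X Z) (2 * 2),
                m • y = singularCohomology.map ℤ ℤ
                  (⟨Subtype.val, continuous_subtype_val⟩ :
                    C(complexPointsCompl X Z, ComplexPoints X)) (2 * 2) z) →
            singularCohomology.ringChange (Int.castRingHom ℂ) (ComplexPoints X) (2 * 2) z ∈
              supportedClasses X (2 * 2) 1))) := by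
  intro hT X hX
  have hX2 : IsSmoothProjective (2 * 2) X := hX
  refine ⟨fun hHC ↦ ⟨?_, ?_⟩, fun h ↦ genericDivisibility_hodgeConjectureFor_four_of_at hX h.1 h.2⟩
  · exact genericDivisibility_at_of_hodgeConjectureFor (p := 2) (by norm_num) hX2 hT hHC
  · intro z hz _
    exact genericDivisibility_hodgeBounded_at_of_hodgeConjectureFor (p := 2) (by norm_num) hHC z hz

end Summit.HodgeConjecture.HodgeConjecture.Theorems

end
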